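import Mathlib

/-!
# No `y`-antiderivative for `x^{r_x} y^{r_y} (y + t xⁿ)^{mp−1}` in characteristic `p` (Perlega 2020, Lemma 6.2.2)

S. Perlega, *A new proof for the embedded resolution of surface singularities in arbitrary characteristic*,
arXiv:2011.14443 [cite: Perlega2020, Ch. 6 §2.1 «A modified version of Moh's bound», Lemma 6.2.2 (arXiv TeX chunk
p0072 of `lit read arxiv:2011.14443`)], verbatim: "**Lemma.** Let `R = K[[x,y]]` with `char(K) = p > 0`. Let
`r_x, r_y, m, n ∈ ℕ` be non-negative integers and `t ∈ K*`. Then there is no element `F ∈ R` such that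
`∂_y(F) = x^{r_x} y^{r_y} (y + t xⁿ)^{mp−1}`."  Printed proof: "Consider the expansion
`x^{r_x} y^{r_y} (y + t xⁿ)^{mp−1} = Σ_{i=0}^{mp−1} C(mp−1, i) t^{mp−1−i} x^{r_x+n(mp−1−i)} y^{r_y+i}`. There is an
index `j` with `0 ≤ j < p` such that `r_y + j ≡ −1 (mod p)` holds. Notice that since `mp − 1 = (m−1)p + (p−1)`, the
equality `C(mp−1, j) = C(m−1, 0)·C(p−1, j) ≠ 0` holds in `K` by [Lucas]. Hence, a term of the form `x^i y^{kp−1}` for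
some `k ∈ ℕ` appears in the expansion … with non-zero coefficient. Since `∂_y(x^i y^{kp}) = 0`, there can be no element
`F ∈ R` such that `∂_y(F) = x^{r_x} y^{r_y} (y + t xⁿ)^{mp−1}` holds."  (The exponent `mp − 1` presupposes `m ≥ 1`;
we carry `1 ≤ m` explicitly — for `m = 0` the natural-number reading `(…)^0` does have antiderivatives when
`p ∤ r_y + 1`.)

This is the printed mechanism behind the third assertion of H. Hauser, S. Perlega, Publ. RIMS **60** (2024)
767–813 [cite: HauserPerlega2024, Lemma 2 p. 789, proof p. 790 L20–L45: "`∂_{y^{p^{e−1}}}(in_ω(F)) =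
λ x^a y^{b−p^{e−1}} (y − t xⁿ)^{p^e − p^{e−1}}` … `∂_y(F′) = x^{a′} y^{b′−1} (y − t xⁿ)^{p−1}` … there exists an index
`0 ≤ i < p` with `(b′+i) ≡ 0 (mod p)`, but `C(p−1, i) ≢ 0 (mod p)`. Hence, both equalities for `∂_y(F′)` cannot be
fulfilled at the same time"] (the case `m = 1`, `t ↦ −t`, up to the unit `λ`: `not_exists_pderiv_eq_C_mul`), and behind
Perlega's Prop. 6.2.3 (4) (the kangaroo bound `d_* < ⌈d/c!⌉·c!`), used in the decisive case (iv) of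
[HauserPerlega2024, Prop. 4 p. 797] = [Perlega2020, Prop. 9.1.4 case (4)].  The tree's
`HauserPerlega2024.dCurv_lt_of_ordH_eq` (PointBlowupFlagTangentBound.lean) proves HP's third assertion by a different
count and records the deviation; this file supplies the printed lemma itself.  Theorems only (no definitions): the
printed product `x^{r_x} y^{r_y} (y + t xⁿ)^N` is written `X x ^ rx * X y ^ ry * (X y + C t * X x ^ n) ^ N` and the
exponent of its `i`-th term `single x (rx + n * (N - i)) + single y (ry + i)` throughout.

## What is proved (sorry-free; `K` a field; two letters `x ≠ y` of any index type `σ`)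

* `not_dvd_choose_prime_sub_one`, `not_dvd_choose_mul_prime_sub_one` — `p ∤ C(p−1, j)` and `p ∤ C(mp−1, j)` for
  `j < p`, `m ≥ 1` (Lucas: `C(mp−1, j) ≡ C(p−1, j)·C(m−1, 0)`).
* `shearedMonomial_eq_sum`, `coeff_shearedMonomial` (+ `shearExponent_apply_y`, `shearExponent_injective` on the
  exponents) — the displayed expansion: the coefficient of
  `x^{r_x + n(N−i)} y^{r_y + i}` in `x^{r_x} y^{r_y} (y + t xⁿ)^N` is `C(N, i)·t^{N−i}` (`i ≤ N`; any field `K`).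
* (private) `coeff_pderiv_eq` — `(∂_y F)_d = (d_y + 1)·F_{d + e_y}` for polynomials (`MvPolynomial.pderiv`).
* `exists_index` — the index `j < p` with `p ∣ r_y + j + 1`.
* `not_exists_coeff_antiderivative` — **the Lemma for power series** `F ∈ K[[σ]]` in characteristic `p`, with
  `∂_y F = G` written coefficientwise as `∀ d, (d_y + 1)·F_{d+e_y} = G_d` (Mathlib has no `MvPowerSeries.pderiv`;
  this is its defining formula, cf. `coeff_pderiv_eq`), `G = x^{r_x} y^{r_y} (y + t xⁿ)^{mp−1}`, `t ≠ 0`, `1 ≤ m`.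
* `not_exists_pderiv_eq` — the Lemma for polynomials `F` via `MvPolynomial.pderiv y`;
  `not_exists_pderiv_eq_C_mul` — the same with a non-zero constant factor (HP's `λ`; use `t ↦ −t` for `y − t xⁿ`).
-/

namespace Literature.AlgebraicGeometry.Resolution.Perlega2020

open MvPolynomial Finsupp Finset

variable {σ : Type*} {K : Type*} [Field K]

/-! ### Binomial coefficients modulo `p` -/

/-- `p ∤ C(p−1, j)` for `j < p` (since `C(p−1,j)·j!·(p−1−j)! = (p−1)!` is prime to `p`).
[cite: Perlega2020, Lemma 6.2.2 (proof, «C(p−1, j) ≠ 0»)] -/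
theorem not_dvd_choose_prime_sub_one {p j : ℕ} (hp : p.Prime) (hj : j < p) : ¬ p ∣ (p - 1).choose j := by
  intro h
  have hj' : j ≤ p - 1 := Nat.le_sub_one_of_lt hj
  have key := Nat.choose_mul_factorial_mul_factorial hj'
  have hdvd : p ∣ (p - 1).factorial := by
    rw [← key]
    exact Dvd.dvd.mul_right (Dvd.dvd.mul_right h _) _
  rw [hp.dvd_factorial] at hdvd
  have := hp.two_le
  omega

/-- Lucas: `C(mp−1, j) ≡ C(p−1, j)·C(m−1, 0) (mod p)`, hence `p ∤ C(mp−1, j)` for `j < p`, `m ≥ 1`.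
[cite: Perlega2020, Lemma 6.2.2 (proof, «since mp − 1 = (m−1)p + (p−1), C(mp−1, j) = C(m−1,0)C(p−1,j) ≠ 0»)] -/
theorem not_dvd_choose_mul_prime_sub_one {p m j : ℕ} (hp : p.Prime) (hm : 1 ≤ m) (hj : j < p) :
    ¬ p ∣ (m * p - 1).choose j := by
  haveI := Fact.mk hp
  obtain ⟨m', rfl⟩ : ∃ m', m = m' + 1 := ⟨m - 1, by omega⟩
  have hp1 : 1 ≤ p := hp.one_le
  have hrew : (m' + 1) * p - 1 = (p - 1) + m' * p := by
    have h1 : (m' + 1) * p = m' * p + p := by rw [Nat.add_mul, Nat.one_mul]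
    rw [h1, Nat.add_sub_assoc hp1, Nat.add_comm]
  have hmod : ((m' + 1) * p - 1) % p = p - 1 := by
    rw [hrew, Nat.add_mul_mod_self_right, Nat.mod_eq_of_lt (Nat.sub_lt hp1 Nat.one_pos)]
  have hdiv : ((m' + 1) * p - 1) / p = m' := by
    rw [hrew, Nat.add_mul_div_right _ _ hp.pos, Nat.div_eq_of_lt (Nat.sub_lt hp1 Nat.one_pos), Nat.zero_add]
  have luc := Choose.choose_modEq_choose_mod_mul_choose_div_nat (n := (m' + 1) * p - 1) (k := j) (p := p)
  rw [hmod, hdiv, Nat.mod_eq_of_lt hj, Nat.div_eq_of_lt hj, Nat.choose_zero_right, Nat.mul_one] at luc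
  intro h
  exact not_dvd_choose_prime_sub_one hp hj ((luc.dvd_iff dvd_rfl).mp h)

/-! ### The displayed expansion of the sheared monomial -/

/-- the `y`-exponent of the `i`-th term `x^{r_x + n(N−i)} y^{r_y + i}` of the expansion is `r_y + i`.
[cite: Perlega2020, Lemma 6.2.2 (proof, displayed expansion)] -/
theorem shearExponent_apply_y {x y : σ} (hxy : x ≠ y) (rx ry n N i : ℕ) :
    (single x (rx + n * (N - i)) + single y (ry + i) : σ →₀ ℕ) y = ry + i := by
  simp [Finsupp.add_apply, hxy]

/-- distinct terms of the expansion have distinct exponents. [cite: Perlega2020, Lemma 6.2.2 (proof)] -/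
theorem shearExponent_injective {x y : σ} (hxy : x ≠ y) (rx ry n N : ℕ) :
    Function.Injective (fun i : ℕ => (single x (rx + n * (N - i)) + single y (ry + i) : σ →₀ ℕ)) := by
  intro i j h
  have := congrArg (fun e : σ →₀ ℕ => e y) h
  simp only [shearExponent_apply_y hxy] at this
  omega

/-- the expansion `x^{r_x} y^{r_y} (y + t xⁿ)^N = Σ_{i ≤ N} C(N,i) t^{N−i} x^{r_x+n(N−i)} y^{r_y+i}` (any field `K`).
[cite: Perlega2020, Lemma 6.2.2 (proof, displayed expansion)] -/
theorem shearedMonomial_eq_sum (x y : σ) (rx ry n N : ℕ) (t : K) :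
    (X x ^ rx * X y ^ ry * (X y + C t * X x ^ n) ^ N : MvPolynomial σ K) =
      ∑ i ∈ range (N + 1),
        monomial (single x (rx + n * (N - i)) + single y (ry + i)) ((N.choose i : K) * t ^ (N - i)) := by
  classical
  rw [add_pow, Finset.mul_sum]
  refine Finset.sum_congr rfl fun i _ => ?_
  rw [mul_pow, ← C_pow, ← pow_mul,
    show ((N.choose i : ℕ) : MvPolynomial σ K) = C ((N.choose i : ℕ) : K) from (map_natCast C _).symm]
  simp only [X_pow_eq_monomial, C_apply, monomial_mul]
  rw [monomial_eq_monomial_iff]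
  left
  constructor
  · ext k
    simp only [Finsupp.add_apply, Finsupp.single_apply, Finsupp.coe_zero, Pi.zero_apply]
    split_ifs <;> ring
  · ring

/-- the coefficient of `x^{r_x+n(N−j)} y^{r_y+j}` in `x^{r_x} y^{r_y} (y + t xⁿ)^N` is `C(N,j) t^{N−j}` (`x ≠ y`,
`j ≤ N`). [cite: Perlega2020, Lemma 6.2.2 (proof)] -/
theorem coeff_shearedMonomial {x y : σ} (hxy : x ≠ y) (rx ry n N : ℕ) (t : K) {j : ℕ} (hj : j ≤ N) :
    coeff (single x (rx + n * (N - j)) + single y (ry + j)) (X x ^ rx * X y ^ ry * (X y + C t * X x ^ n) ^ N) =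
      (N.choose j : K) * t ^ (N - j) := by
  classical
  rw [shearedMonomial_eq_sum, coeff_sum, Finset.sum_eq_single j]
  · simp
  · intro i _ hij
    rw [coeff_monomial, if_neg]
    exact fun h => hij (shearExponent_injective hxy rx ry n N h)
  · intro h
    exact absurd (Finset.mem_range.mpr (Nat.lt_succ_of_le hj)) h

/-! ### The coefficients of `∂_y` -/

/-- `(∂_y F)_d = (d_y + 1)·F_{d + e_y}` for a polynomial `F` (private plumbing: the coefficient formula of the
partial derivative, implicit in «Since `∂_y(x^i y^{kp}) = 0`»). [folklore] -/
private theorem coeff_pderiv_eq [DecidableEq σ] (y : σ) (F : MvPolynomial σ K) (d : σ →₀ ℕ) :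
    coeff d (pderiv y F) = ((d y : K) + 1) * coeff (d + single y 1) F := by
  induction F using MvPolynomial.induction_on' with
  | monomial s a =>
    rw [pderiv_monomial, coeff_monomial, coeff_monomial]
    by_cases hs : s = d + single y 1
    · subst hs
      rw [if_pos (add_tsub_cancel_right d (single y 1)), if_pos rfl]
      simp only [Finsupp.add_apply, Finsupp.single_eq_same, Nat.cast_add, Nat.cast_one]
      ring
    · rw [if_neg hs, mul_zero]
      by_cases hsy : s y = 0
      · simp [hsy]
      · rw [if_neg]
        intro h
        apply hs
        rw [← h]
        ext k
        simp only [Finsupp.add_apply, Finsupp.tsub_apply, Finsupp.single_apply]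
        split_ifs with hk
        · subst hk; omega
        · omega
  | add p q hp hq => rw [map_add, coeff_add, coeff_add, hp, hq, mul_add]

/-- the index of the printed proof: `j < p` with `r_y + j ≡ −1 (mod p)`. [cite: Perlega2020, Lemma 6.2.2 (proof)] -/
theorem exists_index {p : ℕ} (hp : p.Prime) (ry : ℕ) : ∃ j, j < p ∧ p ∣ ry + j + 1 := by
  obtain ⟨r, hr⟩ : ∃ r, r = ry % p := ⟨_, rfl⟩
  have h1 : r < p := hr ▸ Nat.mod_lt _ hp.pos
  have h2 : r ≤ ry := hr ▸ Nat.mod_le _ _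
  have h3 : p ∣ ry - r := hr ▸ Nat.dvd_sub_mod ry
  refine ⟨p - 1 - r, by omega, ?_⟩
  have h4 : ry + (p - 1 - r) + 1 = (ry - r) + p := by omega
  rw [h4]
  exact Dvd.dvd.add h3 dvd_rfl

/-! ### The lemma -/

/-- **[Perlega2020, Lemma 6.2.2]** for power series: in characteristic `p`, for `t ≠ 0`, `m ≥ 1` and letters `x ≠ y`,
there is no `F ∈ K[[σ]]` with `∂_y F = x^{r_x} y^{r_y} (y + t xⁿ)^{mp−1}` — the derivative being written through its
coefficients, `(∂_y F)_d = (d_y + 1)·F_{d+e_y}`. [cite: Perlega2020, Lemma 6.2.2 (arXiv chunk p0072);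
HauserPerlega2024, Lemma 2 proof p. 790 L38–L45 (m = 1)] -/
theorem not_exists_coeff_antiderivative (p : ℕ) [CharP K p] (hp : p.Prime) {x y : σ} (hxy : x ≠ y)
    (rx ry m n : ℕ) (hm : 1 ≤ m) {t : K} (ht : t ≠ 0) :
    ¬ ∃ F : MvPowerSeries σ K, ∀ d : σ →₀ ℕ,
      ((d y : K) + 1) * MvPowerSeries.coeff (d + single y 1) F =
        coeff d (X x ^ rx * X y ^ ry * (X y + C t * X x ^ n) ^ (m * p - 1)) := by
  classical
  rintro ⟨F, hF⟩
  obtain ⟨j, hjp, hdvd⟩ := exists_index hp ry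
  have hjN : j ≤ m * p - 1 := Nat.le_sub_one_of_lt (lt_of_lt_of_le hjp (Nat.le_mul_of_pos_left p hm))
  have h0 : (((single x (rx + n * (m * p - 1 - j)) + single y (ry + j) : σ →₀ ℕ) y : ℕ) : K) + 1 = 0 := by
    rw [shearExponent_apply_y hxy]
    exact_mod_cast (CharP.cast_eq_zero_iff K p (ry + j + 1)).mpr hdvd
  have h := hF (single x (rx + n * (m * p - 1 - j)) + single y (ry + j))
  rw [h0, zero_mul, coeff_shearedMonomial hxy rx ry n _ t hjN] at h
  have hc : (((m * p - 1).choose j : ℕ) : K) ≠ 0 := by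
    rw [Ne, CharP.cast_eq_zero_iff K p]
    exact not_dvd_choose_mul_prime_sub_one hp hm hjp
  exact mul_ne_zero hc (pow_ne_zero _ ht) h.symm

/-- **[Perlega2020, Lemma 6.2.2]** for polynomials: in characteristic `p`, for `t ≠ 0`, `m ≥ 1`, `x ≠ y`, no polynomial
`F` has `∂F/∂y = x^{r_x} y^{r_y} (y + t xⁿ)^{mp−1}`. [cite: Perlega2020, Lemma 6.2.2] -/
theorem not_exists_pderiv_eq (p : ℕ) [CharP K p] (hp : p.Prime) {x y : σ} (hxy : x ≠ y)
    (rx ry m n : ℕ) (hm : 1 ≤ m) {t : K} (ht : t ≠ 0) :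
    ¬ ∃ F : MvPolynomial σ K, pderiv y F = X x ^ rx * X y ^ ry * (X y + C t * X x ^ n) ^ (m * p - 1) := by
  classical
  rintro ⟨F, hF⟩
  refine not_exists_coeff_antiderivative p hp hxy rx ry m n hm ht ⟨(F : MvPowerSeries σ K), fun d => ?_⟩
  rw [MvPolynomial.coeff_coe, ← coeff_pderiv_eq, hF]

/-- the same with a non-zero constant factor `λ` (Hauser–Perlega's shape `λ x^a y^{b′−1}(y − t xⁿ)^{p−1}` is the case
`m = 1` with `−t` for `t`). [cite: HauserPerlega2024, Lemma 2 proof p. 790 L38–L45; Perlega2020, Lemma 6.2.2] -/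
theorem not_exists_pderiv_eq_C_mul (p : ℕ) [CharP K p] (hp : p.Prime) {x y : σ} (hxy : x ≠ y)
    (rx ry m n : ℕ) (hm : 1 ≤ m) {t c : K} (ht : t ≠ 0) (hc : c ≠ 0) :
    ¬ ∃ F : MvPolynomial σ K,
      pderiv y F = C c * (X x ^ rx * X y ^ ry * (X y + C t * X x ^ n) ^ (m * p - 1)) := by
  rintro ⟨F, hF⟩
  refine not_exists_pderiv_eq p hp hxy rx ry m n hm ht ⟨C c⁻¹ * F, ?_⟩
  rw [pderiv_C_mul, hF, ← mul_assoc, ← C_mul, inv_mul_cancel₀ hc, C_1, one_mul]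

end Literature.AlgebraicGeometry.Resolution.Perlega2020
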